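import Literature.NumberTheory.GaloisRepresentations.GrossencharakterConductor
import HarnessLib

/-!
# PRIMITIVITY of an ideal Größencharakter datum ⟺ its modulus IS the conductor — proofs

Topic `NumberTheory/GaloisRepresentations`; namespace `Literature.NumberTheory.GaloisRepresentations`.  THEOREMS ONLY.  Sequel of
`GrossencharakterConductor.lean` (the conductor `𝔠 = ∏_{v ∈ ram ω} 𝔭_v^{f(ω_v)}` of the Hecke character `ω = heckeOfGross h𝔣 hψ` of a datum
`ψ mod 𝔣`, and its primitive companion).  The Literature fact `ModularForms.shimura1972_heckeTheta_isNewform0_of_primitive`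
(`EllipticCurves/CMNewformGamma0PrimitiveIsNewform.lean`) renders «`𝔣` is the conductor of `ψ`» ideal-theoretically as the PRIMITIVITY clause
(P) «no `ψ₁` agreeing with `ψ` off `𝔣` is a Größencharakter of the same type modulo an ideal `𝔣₁ ⊇ 𝔣` other than `𝔣`».  This file CERTIFIES that
rendering: ★ `IsGrossencharakter.primitive_iff_conductor_eq` — (P) holds iff `𝔠 = 𝔣`, i.e. iff the conductor exponents of the idelic realisation
are exactly the exponents of `𝔣` (Neukirch VII §6 (6.11): the conductor is the smallest module of definition; a Größencharakter `mod 𝔣` is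
primitive iff `𝔣 = 𝔣(χ)`).  Also `IsGrossencharakter.conductor_eq_of_primitive` / `.primitive_of_conductor_eq` (the two directions) and
`.modulusExp_eq_conductorExponentAt_of_primitive` (under (P), `ν_v(𝔣) = f(ω_v)` for all `v`).

References: [NeukirchANT1999] Ch. VII §6 Def. (6.1), (6.11), Cor. (6.14); [CasselsFrohlichANT1967] Ch. VII §4 Prop. 4.1.  Filed for crux L
`SmallImageLowerHalfBothSigns` of `Summits/BirchSwinnertonDyer` (the Shimura de-cite); nothing about BSD is proved here.
`lean search 'primitive_iff_conductor|conductor_eq_of_primitive'` (2026-08-31): nothing.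
-/

noncomputable section

open scoped NumberField
open NumberField IsDedekindDomain Filter

namespace Literature.NumberTheory.GaloisRepresentations

variable {K : Type} [Field K] [NumberField K] {𝔣 : Ideal (𝓞 K)} {p q : InfinitePlace K → ℤ} {ψ : HeightOneSpectrum (𝓞 K) → ℂ}

/-- **Primitive ⇒ the modulus is the conductor**: if no `ψ₁` agreeing with `ψ` off `𝔣` is a Größencharakter of type `(p, q)` modulo a proper
`𝔣₁ ⊇ 𝔣`, then `𝔣` is the conductor `∏_{v ∈ ram ω} 𝔭_v^{f(ω_v)}` of `ω = heckeOfGross h𝔣 hψ` (apply the clause to the primitive companion).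
[cite: NeukirchANT1999, Ch. VII §6 (6.11) and Cor. (6.14)] -/
theorem IsGrossencharakter.conductor_eq_of_primitive (h𝔣 : 𝔣 ≠ ⊥) (hψ : IsGrossencharakter 𝔣 p q ψ)
    (hprim : ∀ (𝔣₁ : Ideal (𝓞 K)) (ψ₁ : HeightOneSpectrum (𝓞 K) → ℂ), 𝔣 ≤ 𝔣₁ →
      (∀ v : HeightOneSpectrum (𝓞 K), ¬ 𝔣 ≤ v.asIdeal → ψ₁ v = ψ v) → IsGrossencharakter 𝔣₁ p q ψ₁ → 𝔣₁ = 𝔣) :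
    (∏ v ∈ (HeckeCharacter.finite_ramifiedPlaces_holds (heckeOfGross h𝔣 hψ)).toFinset,
      v.asIdeal ^ (heckeOfGross h𝔣 hψ).conductorExponentAt v) = 𝔣 :=
  hprim _ _ (hψ.le_conductor h𝔣) (fun _ hv => heckeOfGross_valueAtUniformizer h𝔣 hψ hv) (hψ.isGrossencharakter_conductor h𝔣)

/-- **The modulus is the conductor ⇒ primitive**: if `𝔣` equals the conductor of `ω = heckeOfGross h𝔣 hψ`, then no `ψ₁` agreeing with `ψ` off
`𝔣` is a Größencharakter of type `(p, q)` modulo a proper `𝔣₁ ⊇ 𝔣` (`eq_conductor_of_le`: multiplicity one + minimality of the exponents).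
[cite: NeukirchANT1999, Ch. VII §6 (6.11) and Cor. (6.14)] [cite: CasselsFrohlichANT1967, Ch. VII §4 Prop. 4.1] -/
theorem IsGrossencharakter.primitive_of_conductor_eq (h𝔣 : 𝔣 ≠ ⊥) (hψ : IsGrossencharakter 𝔣 p q ψ)
    (h𝔠 : (∏ v ∈ (HeckeCharacter.finite_ramifiedPlaces_holds (heckeOfGross h𝔣 hψ)).toFinset,
      v.asIdeal ^ (heckeOfGross h𝔣 hψ).conductorExponentAt v) = 𝔣) :
    ∀ (𝔣₁ : Ideal (𝓞 K)) (ψ₁ : HeightOneSpectrum (𝓞 K) → ℂ), 𝔣 ≤ 𝔣₁ →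
      (∀ v : HeightOneSpectrum (𝓞 K), ¬ 𝔣 ≤ v.asIdeal → ψ₁ v = ψ v) → IsGrossencharakter 𝔣₁ p q ψ₁ → 𝔣₁ = 𝔣 := by
  intro 𝔣₁ ψ₁ hle hagree hψ₁
  have h := hψ.eq_conductor_of_le h𝔣 (𝔣₁ := 𝔣₁) (ψ₁ := ψ₁) (by rw [h𝔠]; exact hle)
    (fun v hv => by
      rw [h𝔠] at hv
      rw [hagree v hv, heckeOfGross_valueAtUniformizer h𝔣 hψ hv]) hψ₁
  rw [h, h𝔠]

/-- ★ **PRIMITIVITY ⟺ THE MODULUS IS THE CONDUCTOR** (Neukirch VII §6: a Größencharakter `mod 𝔣` is primitive iff `𝔣` is its conductor, the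
smallest module of definition).  This certifies the ideal-theoretic primitivity clause of `ModularForms.shimura1972_heckeTheta_isNewform0_of_primitive`.
[cite: NeukirchANT1999, Ch. VII §6 Def. (6.1), (6.11), Cor. (6.14)] -/
theorem IsGrossencharakter.primitive_iff_conductor_eq (h𝔣 : 𝔣 ≠ ⊥) (hψ : IsGrossencharakter 𝔣 p q ψ) :
    (∀ (𝔣₁ : Ideal (𝓞 K)) (ψ₁ : HeightOneSpectrum (𝓞 K) → ℂ), 𝔣 ≤ 𝔣₁ →
      (∀ v : HeightOneSpectrum (𝓞 K), ¬ 𝔣 ≤ v.asIdeal → ψ₁ v = ψ v) → IsGrossencharakter 𝔣₁ p q ψ₁ → 𝔣₁ = 𝔣) ↔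
    (∏ v ∈ (HeckeCharacter.finite_ramifiedPlaces_holds (heckeOfGross h𝔣 hψ)).toFinset,
      v.asIdeal ^ (heckeOfGross h𝔣 hψ).conductorExponentAt v) = 𝔣 :=
  ⟨hψ.conductor_eq_of_primitive h𝔣, hψ.primitive_of_conductor_eq h𝔣⟩

/-- Under primitivity the primes of `𝔣` are EXACTLY the ramified places of `ω = heckeOfGross h𝔣 hψ` (sharp support).
[cite: NeukirchANT1999, Ch. VII §6 (6.11)] -/
theorem IsGrossencharakter.le_asIdeal_iff_of_primitive (h𝔣 : 𝔣 ≠ ⊥) (hψ : IsGrossencharakter 𝔣 p q ψ)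
    (hprim : ∀ (𝔣₁ : Ideal (𝓞 K)) (ψ₁ : HeightOneSpectrum (𝓞 K) → ℂ), 𝔣 ≤ 𝔣₁ →
      (∀ v : HeightOneSpectrum (𝓞 K), ¬ 𝔣 ≤ v.asIdeal → ψ₁ v = ψ v) → IsGrossencharakter 𝔣₁ p q ψ₁ → 𝔣₁ = 𝔣)
    (w : HeightOneSpectrum (𝓞 K)) : 𝔣 ≤ w.asIdeal ↔ ¬ (heckeOfGross h𝔣 hψ).IsUnramifiedAt w := by
  rw [← hψ.conductor_le_asIdeal_iff h𝔣 w, hψ.conductor_eq_of_primitive h𝔣 hprim]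

/-- Under primitivity, every Hecke character realising `ψ` at almost all uniformisers is ramified exactly at the primes of `𝔣` (the (prim′)
export shape of the crux-L producer, for the ORIGINAL datum). [cite: NeukirchANT1999, Ch. VII §6 (6.11)] [cite: CasselsFrohlichANT1967, Ch. VII §4 Prop. 4.1] -/
theorem IsGrossencharakter.sharp_of_primitive (h𝔣 : 𝔣 ≠ ⊥) (hψ : IsGrossencharakter 𝔣 p q ψ)
    (hprim : ∀ (𝔣₁ : Ideal (𝓞 K)) (ψ₁ : HeightOneSpectrum (𝓞 K) → ℂ), 𝔣 ≤ 𝔣₁ →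
      (∀ v : HeightOneSpectrum (𝓞 K), ¬ 𝔣 ≤ v.asIdeal → ψ₁ v = ψ v) → IsGrossencharakter 𝔣₁ p q ψ₁ → 𝔣₁ = 𝔣)
    {χ : HeckeCharacter K} (hχ : ∀ᶠ v in cofinite, χ.valueAtUniformizer v = ψ v) (w : HeightOneSpectrum (𝓞 K)) :
    𝔣 ≤ w.asIdeal ↔ ¬ χ.IsUnramifiedAt w := by
  rw [eq_heckeOfGross_of_eventually_valueAtUniformizer_eq h𝔣 hψ hχ]
  exact hψ.le_asIdeal_iff_of_primitive h𝔣 hprim w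

end Literature.NumberTheory.GaloisRepresentations

end
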